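import Summits.QuantumFields.BalabanUV.T4Continuum.Support.AveragingDeficitTwoLevelFermat

/-!
# AveragingDeficitMultiLevelPrep (T⁴ programme, node NE3, row NE3-R2, gen 3) — THE `k`-LEVEL COMPOSITE CONSTRAINT OF
# BAŁABAN'S AVERAGE: tower of periods, iterated averages, the multi-level constraint map and its differential, multi-level
# smallness, decoding and tangency (file 1/2 of the multi-level instance of R0; file 2/2 = `AveragingDeficitMultiLevelFermat`)

HONEST FRAMING (cell `pub-balaban`, T4-DAG PAGE 1; unit `b2b-balaban-t4-ne3r2-p1` = owner of BINDER-OWNERS row NE3-R2,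
gen 3).  The cell's T4 target is the finite-torus continuum limit of the unit-scale averaged loop expectations — NOT
infinite volume, NO mass gap, NOT Clay, NOT summit progress.  B11 §E compares the minimiser `U_{k+1}(V)` of the fine
action under the `(k+1)`-FOLD composite averaging constraint, averaged once, with the `k`-fold minimiser `U_k`; gen 3's
`AveragingDeficitFermat` proved R0 for an abstract constraint through the average and `AveragingDeficitTwoLevelFermat`
instantiated it for TWO levels.  THIS FILE and its sequel do the general number of levels by induction on the tower,
all [folklore], 0 sorry: §1 `tower L M′ j = L^j·M′` (structural recursion, `NeZero` instance), `cavgIter L i` (iterated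
averages read on successively coarser unit lattices), the constraint map `levelQ L M′ j W₁ W = skewPR(log((cavgIter (j+1)
W₁)(b)⁻¹·(cavgIter (j+1) W)(b)))_b` (`levelQ 0 = twoLevelQ`, `levelQ (j+1) W₁ W = levelQ j (cavg W₁) (cavg W)`, both
`rfl`) and its differential `levelQ'` by recursion (`levelQ' (j+1) W₁ = levelQ' j (cavg W₁) ∘ D coord_id(W₁)(0)`);
§2 `radIter`, the multi-level smallness `LevelSmall d L j x` (two-level smallness at every level of the tower;
`levelSmall_of_pow`: implied by `twoLevelSmall·(2L²)^j·x ≤ 1`; `LevelSmall.mono`), `isPeriodicCfg_cavgIter`,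
**`cavgIter_unitary_small`** (iterated averages are unitary and small-field — B7 Prop. 1 at every level, tree
`prop1_explicit` BY NAME via `smallField_cavg`), `ball_of_small`; §3 `eventually_cavg_chart_eq'` (the average of the
chart is the coarse chart of its coordinates, any linear insert), `eq_of_skewPR_relLog_eq_zero` (DECODING at the top
torus), `cpush` (the push-forward read on the coarse unit lattice), `TangentIter L j W φ` (tangency to the fibre of the
`(j+1)`-fold average, B11's `T = ker DQ̄_k`, by recursion), `isPeriodicDir_cpush`, `fderiv_coord_resDir`, and
**`levelQ'_resDir_eq_zero`** (tangency ⇒ admissibility `levelQ' j W₁ (res φ) = 0`, by induction on the tower).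
NE3 ITSELF IS NOT PROVED (ML, (γ2)–(γ4), δ remain; record `t4/T4-EST-NE3-P2.md` §0 (e)); NE3 stays COND-free.
CITATION HEADER: no printed sentence is a hypothesis; the manuscripts under audit are not cited for any disputed step;
context: T. Bałaban, Commun. Math. Phys. **98** (1985) 17–51 [Balaban1985Averaging] ((42) p. 23, Prop. 1 p. 24);
**102** (1985) 277–309 [Balaban1985Variational] ((83) p. 290, §E (115)–(121) p. 295).
PLACEMENT: `Summits/QuantumFields/BalabanUV/` (human rule 2026-08-19).  Record: HOME `t4/T4-EST-NE3-R2.md` v0.4.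
-/

set_option autoImplicit false

open scoped BigOperators Matrix Matrix.Norms.L2Operator Topology
open NormedSpace Finset Filter

namespace Summit.QuantumFields.BalabanUV.T4Continuum.AveragingDeficitMultiLevelPrep

open Literature.MathematicalPhysics.QuantumFieldTheory.Balaban1983to89
open B7Prop1Explicit B7Prop2Explicit MatrixLog UnitaryModel
open T4AveragingDeficitWall hiding Site Plane Plaq Bond
open T4AveragingDeficitWallBoundary (IsPeriodicCfg periodBox)
open T4AveragingDeficitNonAbelian (hol_add_period)
open AveragingDeficitTransport AveragingDeficitPlaqDeriv AveragingDeficitSideDeriv AveragingDeficitPeriodicCounting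
open AveragingDeficitDerivWallProof AveragingDeficitResidualPairing AveragingDeficitFaceWords AveragingDeficitFaceLift
open AveragingDeficitLiftPeriodic
open AveragingDeficitDualResidual AveragingDeficitTorusChart AveragingDeficitChartCalculus AveragingDeficitFermat
open AveragingDeficitTwoLevelPrep AveragingDeficitTwoLevelFermat

noncomputable section

variable {d : ℕ} {n : Type*} [Fintype n] [DecidableEq n]

local notation "𝕄" => Matrix n n ℂ
local notation "Site" => B7Prop1Explicit.Site

/-! ## §1 The tower of periods, iterated averages, the multi-level constraint map and its differential -/

/-- The tower of periods `tower L M′ j = L^j·M′`, by structural recursion (`tower (j+1) = L·tower j` definitionally). [folklore] -/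
def tower (L M' : ℕ) : ℕ → ℕ
  | 0 => M'
  | j + 1 => L * tower L M' j

omit [Fintype n] [DecidableEq n] in
/-- `tower L M′ j ≠ 0`. [folklore] -/
theorem tower_ne_zero (L M' : ℕ) [NeZero L] [NeZero M'] : ∀ j : ℕ, tower L M' j ≠ 0
  | 0 => NeZero.ne M'
  | j + 1 => Nat.mul_ne_zero (NeZero.ne L) (tower_ne_zero L M' j)

/-- `tower L M′ j` is non-zero for non-zero `L`, `M′` (instance, so that `redN`/`chart` at every level elaborate). [folklore] -/
instance tower_neZero (L M' : ℕ) [NeZero L] [NeZero M'] (j : ℕ) : NeZero (tower L M' j) := ⟨tower_ne_zero L M' j⟩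

omit [Fintype n] [DecidableEq n] in
/-- The cast of `tower (j+1)`. [folklore] -/
theorem natCast_tower_succ (L M' : ℕ) (j : ℕ) : ((tower L M' (j + 1) : ℕ) : ℤ) = (L : ℤ) * (tower L M' j : ℕ) := by
  simp only [tower]; push_cast; ring

/-- ITERATED AVERAGES read on successively coarser unit lattices: `cavgIter L 0 W = W`,
`cavgIter L (i+1) W = cavgIter L i (cavg L W)` (B7's `k`-fold average). [cite: Balaban1985Averaging, (42) p.23] -/
def cavgIter (L : ℕ) : ℕ → (Site d → Fin d → 𝕄ˣ) → (Site d → Fin d → 𝕄ˣ)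
  | 0, W => W
  | i + 1, W => cavgIter L i (cavg L W)

/-- **THE MULTI-LEVEL CONSTRAINT MAP** at base `W₁` with `j + 2` levels: the `𝔲(N)` part of the chart coordinates of the
`(j+1)`-fold average of `W` relative to that of `W₁`, on the bonds of the top torus `[0,M′)^d`:
`levelQ L M′ j W₁ W = skewPR(log((cavgIter (j+1) W₁)(b)⁻¹ · (cavgIter (j+1) W)(b)))_b`; `levelQ 0 = twoLevelQ`,
`levelQ (j+1) W₁ W = levelQ j (cavg W₁) (cavg W)` (both `rfl`). [cite: Balaban1985Variational, (115)–(121) p.295] -/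
def levelQ (L M' : ℕ) (j : ℕ) (W₁ W : Site d → Fin d → 𝕄ˣ) : ↥(skewSub d n M') :=
  skewPR M' (relLog M' (cavgIter L (j + 1) W₁) (cavgIter L (j + 1) W))

/-- `levelQ 0 = twoLevelQ`. [folklore] -/
theorem levelQ_zero (L M' : ℕ) (W₁ W : Site d → Fin d → 𝕄ˣ) : levelQ L M' 0 W₁ W = twoLevelQ L M' W₁ W := rfl

/-- `levelQ (j+1) W₁ W = levelQ j (cavg W₁) (cavg W)`. [folklore] -/
theorem levelQ_succ (L M' : ℕ) (j : ℕ) (W₁ W : Site d → Fin d → 𝕄ˣ) :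
    levelQ L M' (j + 1) W₁ W = levelQ L M' j (cavg L W₁) (cavg L W) := rfl

/-- `levelQ j W₁ W₁ = 0`. [folklore] -/
theorem levelQ_self (L M' : ℕ) (j : ℕ) (W₁ : Site d → Fin d → 𝕄ˣ) : levelQ L M' j W₁ W₁ = (0 : ↥(skewSub d n M')) := by
  simp only [levelQ, relLog_self, map_zero]

/-- THE DIFFERENTIAL of the multi-level constraint map in the chart at `W₁` (base period `L·tower j`), by recursion:
`levelQ' 0 = twoLevelQ'`, `levelQ' (j+1) W₁ = levelQ' j (cavg W₁) ∘ D coord_id(W₁)(0)`. [folklore] -/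
def levelQ' (L M' : ℕ) [NeZero L] [NeZero M'] :
    (j : ℕ) → (Site d → Fin d → 𝕄ˣ) → (TDir d n (L * tower L M' j) →L[ℝ] ↥(skewSub d n M'))
  | 0, W₁ => twoLevelQ' L M' W₁
  | j + 1, W₁ => (levelQ' L M' j (cavg L W₁)).comp
      (fderiv ℝ (coord (ContinuousLinearMap.id ℝ 𝕄) L (L * tower L M' j) W₁) 0)

/-! ## §2 Multi-level smallness; the iterated averages are periodic, unitary and small-field -/

/-- The radius after `i` averaging steps: `radIter 0 x = x`, `radIter (i+1) x = radIter i (prop1Radius x)`. [folklore] -/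
def radIter (d L : ℕ) : ℕ → ℝ → ℝ
  | 0, x => x
  | i + 1, x => radIter d L i (prop1Radius d L x)

/-- THE MULTI-LEVEL SMALLNESS: `LevelSmall 0 x :⟺ twoLevelSmall·x ≤ 1`,
`LevelSmall (j+1) x :⟺ twoLevelSmall·x ≤ 1 ∧ LevelSmall j (prop1Radius x)` (the two-level smallness at every level of the
tower; implied by `twoLevelSmall·(2L²)^j·x ≤ 1`, `levelSmall_of_pow`). [folklore] -/
def LevelSmall (d L : ℕ) : ℕ → ℝ → Prop
  | 0, x => twoLevelSmall d L * x ≤ 1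
  | j + 1, x => twoLevelSmall d L * x ≤ 1 ∧ LevelSmall d L j (prop1Radius d L x)

omit [Fintype n] [DecidableEq n] in
/-- Every level of `LevelSmall` contains the two-level smallness. [folklore] -/
theorem LevelSmall.two {j : ℕ} {L : ℕ} {x : ℝ} (h : LevelSmall d L j x) : twoLevelSmall d L * x ≤ 1 := by
  cases j with
  | zero => exact h
  | succ j => exact h.1

omit [Fintype n] [DecidableEq n] in
/-- `prop1Radius` is monotone on `[0, ∞)`. [folklore] -/
theorem prop1Radius_mono {L : ℕ} {x y : ℝ} (hx : 0 ≤ x) (hxy : x ≤ y) : prop1Radius d L x ≤ prop1Radius d L y := by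
  unfold prop1Radius
  have h0 : 0 ≤ 8 * ((d : ℝ) + 1) * ((d : ℝ) + 4) * (L : ℝ) ^ 2 := by positivity
  have h1 : 8 * ((d : ℝ) + 1) * ((d : ℝ) + 4) * (L : ℝ) ^ 2 * x ≤ 8 * ((d : ℝ) + 1) * ((d : ℝ) + 4) * (L : ℝ) ^ 2 * y :=
    mul_le_mul_of_nonneg_left hxy h0
  have h2 : 0 ≤ 8 * ((d : ℝ) + 1) * ((d : ℝ) + 4) * (L : ℝ) ^ 2 * x := by positivity
  nlinarith [pow_le_pow_left₀ h2 h1 2]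

omit [Fintype n] [DecidableEq n] in
/-- `prop1Radius` is nonnegative on `[0, ∞)`. [folklore] -/
theorem prop1Radius_nonneg {L : ℕ} {x : ℝ} (hx : 0 ≤ x) : 0 ≤ prop1Radius d L x := by unfold prop1Radius; positivity

omit [Fintype n] [DecidableEq n] in
/-- `LevelSmall` is monotone: smaller radii are smaller. [folklore] -/
theorem LevelSmall.mono {L : ℕ} : ∀ {j : ℕ} {x y : ℝ}, 0 ≤ x → x ≤ y → LevelSmall d L j y → LevelSmall d L j x
  | 0, x, y, _, hxy, h => by
      have h0 : 0 ≤ twoLevelSmall d L := by unfold twoLevelSmall; positivity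
      exact (mul_le_mul_of_nonneg_left hxy h0).trans h
  | j + 1, x, y, hx, hxy, h => by
      have h0 : 0 ≤ twoLevelSmall d L := by unfold twoLevelSmall; positivity
      exact ⟨(mul_le_mul_of_nonneg_left hxy h0).trans h.1,
        LevelSmall.mono (prop1Radius_nonneg hx) (prop1Radius_mono hx hxy) h.2⟩

omit [Fintype n] [DecidableEq n] in
/-- **Closed-form sufficient condition**: `twoLevelSmall·(2L²)^j·x ≤ 1 ⇒ LevelSmall j x`. [folklore] -/
theorem levelSmall_of_pow {L : ℕ} (hL : 1 ≤ L) : ∀ (j : ℕ) {x : ℝ}, 0 ≤ x →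
    twoLevelSmall d L * (2 * (L : ℝ) ^ 2) ^ j * x ≤ 1 → LevelSmall d L j x
  | 0, x, _, h => by show twoLevelSmall d L * x ≤ 1; simpa using h
  | j + 1, x, hx, h => by
      have h0 : 0 ≤ twoLevelSmall d L := by unfold twoLevelSmall; positivity
      have hL1 : (1 : ℝ) ≤ L := by exact_mod_cast hL
      have h2L : (1 : ℝ) ≤ 2 * (L : ℝ) ^ 2 := by nlinarith [one_le_pow₀ (n := 2) hL1]
      have hpow : (1 : ℝ) ≤ (2 * (L : ℝ) ^ 2) ^ (j + 1) := one_le_pow₀ h2L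
      have hbase : twoLevelSmall d L * x ≤ 1 := by
        have : twoLevelSmall d L * x * 1 ≤ twoLevelSmall d L * x * (2 * (L : ℝ) ^ 2) ^ (j + 1) :=
          mul_le_mul_of_nonneg_left hpow (by positivity)
        linarith
      obtain ⟨-, hr0, hrle, -⟩ := smallness_of_twoLevelSmall (d := d) hL hx hbase
      refine ⟨hbase, levelSmall_of_pow hL j hr0 ?_⟩
      have : twoLevelSmall d L * (2 * (L : ℝ) ^ 2) ^ j * prop1Radius d L x
          ≤ twoLevelSmall d L * (2 * (L : ℝ) ^ 2) ^ j * (2 * (L : ℝ) ^ 2 * x) :=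
        mul_le_mul_of_nonneg_left hrle (by positivity)
      have e : twoLevelSmall d L * (2 * (L : ℝ) ^ 2) ^ j * (2 * (L : ℝ) ^ 2 * x)
          = twoLevelSmall d L * (2 * (L : ℝ) ^ 2) ^ (j + 1) * x := by ring
      linarith

/-- Iterated averages of periodic configurations are periodic: period `tower i P` at the base gives period `P` after
`i` steps. [folklore] -/
theorem isPeriodicCfg_cavgIter (L P : ℕ) : ∀ (i : ℕ) {W : Site d → Fin d → 𝕄ˣ},
    IsPeriodicCfg W ((tower L P i : ℕ) : ℤ) → IsPeriodicCfg (cavgIter L i W) (P : ℤ)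
  | 0, _, h => h
  | i + 1, W, h => by
      rw [natCast_tower_succ] at h
      exact isPeriodicCfg_cavgIter L P i (isPeriodicCfg_cavg L (tower L P i) h)

/-- **Iterated averages are unitary and small-field**: under `LevelSmall i x` the `(i+1)`-fold average of a unitary
configuration with `|W(∂p) − 1| ≤ x` is unitary with `|·(∂p) − 1| ≤ radIter (i+1) x` (B7 Prop. 1 at every level, tree
`prop1_explicit` BY NAME through `smallField_cavg`). [cite: Balaban1985Averaging, Prop. 1 p.24] -/
theorem cavgIter_unitary_small [Nonempty n] {L : ℕ} (hL : 1 ≤ L) (i : ℕ) : ∀ {W : Site d → Fin d → 𝕄ˣ} {x : ℝ},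
    IsUnitaryCfg W → 0 ≤ x → LevelSmall d L i x → SmallField W x →
      IsUnitaryCfg (cavgIter L (i + 1) W) ∧ 0 ≤ radIter d L (i + 1) x
        ∧ SmallField (cavgIter L (i + 1) W) (radIter d L (i + 1) x) := by
  induction i with
  | zero =>
      intro W x hW hx hs hWx
      obtain ⟨hlift, hr0, -, -⟩ := smallness_of_twoLevelSmall (d := d) hL hx hs
      have h512 := small512_of_liftSmall hL hx hlift
      exact ⟨cavg_isUnitaryCfg hL hW hx h512 hWx, hr0, smallField_cavg hL hW hx h512 hWx⟩
  | succ i ih =>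
      intro W x hW hx hs hWx
      obtain ⟨hlift, hr0, -, -⟩ := smallness_of_twoLevelSmall (d := d) hL hx hs.1
      have h512 := small512_of_liftSmall hL hx hlift
      exact ih (cavg_isUnitaryCfg hL hW hx h512 hWx) hr0 hs.2 (smallField_cavg hL hW hx h512 hWx)

/-- The ball hypothesis of the chart calculus for a unitary small-field configuration. [folklore] -/
theorem ball_of_small [Nonempty n] {L : ℕ} (hL : 1 ≤ L) {W : Site d → Fin d → 𝕄ˣ} (hW : IsUnitaryCfg W) {x : ℝ}
    (hx : 0 ≤ x) (hs : twoLevelSmall d L * x ≤ 1) (hWx : SmallField W x) :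
    ∀ (q : Site d) (κ : Fin d) (r : Fin d → Fin L), ‖((Wcx L W q κ (boxVec L r) : 𝕄ˣ) : 𝕄) - 1‖ < 1 := by
  obtain ⟨hlift, -, -, -⟩ := smallness_of_twoLevelSmall (d := d) hL hx hs
  exact norm_Wcx_sub_one_lt_one_of_smallField L hL hW hx (small512_of_liftSmall hL hx hlift) hWx

/-! ## §3 The average of the chart is the coarse chart of its coordinates (any insert); decoding; tangency -/

/-- `eventually_cavg_chart_eq` for an arbitrary linear insert `P`: near `0`,
`cavg L (chart P (LM) V ψ) = chart_id M (cavg L V) (coord P L M V ψ)`. [folklore] -/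
theorem eventually_cavg_chart_eq' [Nonempty n] (P : 𝕄 →L[ℝ] 𝕄) {L M : ℕ} [NeZero M] [NeZero (L * M)]
    {V : Site d → Fin d → 𝕄ˣ} (hVP : IsPeriodicCfg V ((L : ℤ) * M))
    (hW : ∀ (q : Site d) (κ : Fin d) (r : Fin d → Fin L), ‖((Wcx L V q κ (boxVec L r) : 𝕄ˣ) : 𝕄) - 1‖ < 1) :
    ∀ᶠ ψ in 𝓝 (0 : TDir d n (L * M)),
      cavg L (chart P (L * M) V ψ) = chart (ContinuousLinearMap.id ℝ 𝕄) M (cavg L V) (coord P L M V ψ) := by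
  have hball : ∀ᶠ ψ in 𝓝 (0 : TDir d n (L * M)), ∀ rκ : (Fin d → Fin M) × Fin d,
      ‖(((cavg L V (boxVec M rκ.1) rκ.2)⁻¹ : 𝕄ˣ) : 𝕄)
          * ((cavg L (chart P (L * M) V ψ) (boxVec M rκ.1) rκ.2 : 𝕄ˣ) : 𝕄) - 1‖ < 1 := by
    refine Filter.eventually_all.mpr fun rκ => ?_
    have hc : ContinuousAt (fun ψ : TDir d n (L * M) => ‖(((cavg L V (boxVec M rκ.1) rκ.2)⁻¹ : 𝕄ˣ) : 𝕄)
        * ((cavg L (chart P (L * M) V ψ) (boxVec M rκ.1) rκ.2 : 𝕄ˣ) : 𝕄) - 1‖) 0 := by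
      refine ((continuousAt_const.mul ?_).sub continuousAt_const).norm
      exact (contDiffAt_val_bavg_chart (m := 0) P (L * M) V L _ rκ.2 0
        (by rw [chart_zero]; exact hW _ _)).continuousAt
    have h0 : ‖(((cavg L V (boxVec M rκ.1) rκ.2)⁻¹ : 𝕄ˣ) : 𝕄)
        * ((cavg L (chart P (L * M) V 0) (boxVec M rκ.1) rκ.2 : 𝕄ˣ) : 𝕄) - 1‖ < 1 := by
      rw [chart_zero, Units.inv_mul, sub_self, norm_zero]
      exact one_pos
    exact hc.eventually (gt_mem_nhds h0)
  refine hball.mono fun ψ hψ => ?_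
  have hperV : IsPeriodicCfg (cavg L V) (M : ℤ) := isPeriodicCfg_cavg L M hVP
  have hperU : IsPeriodicCfg (cavg L (chart P (L * M) V ψ)) (M : ℤ) :=
    isPeriodicCfg_cavg L M (by
      have h := isPeriodicCfg_chart P (L * M) (V := V) (by rw [natCast_mul_period]; exact hVP) ψ
      rw [natCast_mul_period] at h
      exact h)
  funext y κ
  apply Units.ext
  have hy := eq_wrap_add M y
  set r := redN M y with hr
  have e1 : cavg L (chart P (L * M) V ψ) y κ = cavg L (chart P (L * M) V ψ) (boxVec M r) κ := by
    conv_lhs => rw [hy]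
    exact periodic_smul_vec (f := fun z => cavg L (chart P (L * M) V ψ) z κ) (fun z i => hperU z i κ) _ _
  have e2 : cavg L V y κ = cavg L V (boxVec M r) κ := by
    conv_lhs => rw [hy]
    exact periodic_smul_vec (f := fun z => cavg L V z κ) (fun z i => hperV z i κ) _ _
  rw [e1]
  simp only [chart, chartDir, ContinuousLinearMap.id_apply, coord, relLog, Units.val_mul, val_expUnit, ← hr]
  rw [exp_mlog (hψ (r, κ)), e2, ← mul_assoc, Units.mul_inv, one_mul]

/-- **DECODING** at the top torus: for `M′`-periodic unitary configurations `X₀, X` bondwise within `1/4` (relative) on the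
torus bonds, `skewPR(log(X₀(b)⁻¹X(b)))_b = 0 ⇒ X = X₀`. [folklore] -/
theorem eq_of_skewPR_relLog_eq_zero {M' : ℕ} [NeZero M'] {X₀ X : Site d → Fin d → 𝕄ˣ}
    (hX₀P : IsPeriodicCfg X₀ (M' : ℤ)) (hXP : IsPeriodicCfg X (M' : ℤ)) (hX₀u : IsUnitaryCfg X₀) (hXu : IsUnitaryCfg X)
    (hnear : ∀ (r : Fin d → Fin M') (κ : Fin d),
      ‖(((X₀ (boxVec M' r) κ)⁻¹ : 𝕄ˣ) : 𝕄) * (X (boxVec M' r) κ : 𝕄) - 1‖ ≤ 1 / 4)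
    (hQ : skewPR M' (relLog M' X₀ X) = 0) : X = X₀ := by
  have hb : ∀ (r : Fin d → Fin M') (κ : Fin d), X (boxVec M' r) κ = X₀ (boxVec M' r) κ := by
    intro r κ
    refine eq_of_skewP_mlog_eq_zero (hX₀u _ _) (hXu _ _) (hnear r κ) ?_
    have h := congrArg (fun Ψ : ↥(skewSub d n M') => (Ψ : TDir d n M') r κ) hQ
    simpa [skewPR, relLog] using h
  funext y κ
  rw [eq_wrap_add M' y, periodic_smul_vec (f := fun z => X z κ) (fun z i => hXP z i κ),
    periodic_smul_vec (f := fun z => X₀ z κ) (fun z i => hX₀P z i κ)]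
  exact hb _ _

/-- The push-forward of a coarse direction read on the coarse unit lattice: `(cpush L W φ)(z,κ) = pushDir L W φ (L·z) κ`
(the differential of the average as a map of unit-lattice fields). [cite: Balaban1985Averaging, (42) p.23] -/
def cpush (L : ℕ) (W : Site d → Fin d → 𝕄ˣ) (φ : Site d → Fin d → 𝕄) : Site d → Fin d → 𝕄 :=
  fun z κ => pushDir L W φ ((L : ℤ) • z) κ

/-- TANGENCY TO THE FIBRE OF THE `(j+1)`-FOLD AVERAGE at base `W` (B11's `T = ker D Q̄_k`), by recursion on the tower:
`TangentIter 0 W φ :⟺ cpush L W φ = 0`, `TangentIter (j+1) W φ :⟺ TangentIter j (cavg W) (cpush L W φ)`.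
[cite: Balaban1985Variational, (83) p.290] -/
def TangentIter (L : ℕ) : ℕ → (Site d → Fin d → 𝕄ˣ) → (Site d → Fin d → 𝕄) → Prop
  | 0, W, φ => cpush L W φ = 0
  | j + 1, W, φ => TangentIter L j (cavg L W) (cpush L W φ)

/-- The push-forward of periodic data is periodic on the coarse unit lattice: `W` and `φ` of period `L·N` give
`cpush L W φ` of period `N`. [folklore] -/
theorem isPeriodicDir_cpush (L N : ℕ) {W : Site d → Fin d → 𝕄ˣ} (hW : IsPeriodicCfg W ((L : ℤ) * N))
    {φ : Site d → Fin d → 𝕄} (hφ : IsPeriodicDir φ ((L : ℤ) * N)) : IsPeriodicDir (cpush L W φ) (N : ℤ) := by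
  intro z i κ
  simp only [cpush, smul_add, smul_smul]
  set t : Site d := ((L : ℤ) * N) • e i with ht
  have hWt : ∀ (x : Site d) (μ : Fin d), W (x + t) μ = W x μ := fun x μ => hW x i μ
  have hφt : shiftDir t φ = φ := by
    funext w μ
    simp only [shiftDir, sub_eq_add_neg, ht, ← smul_neg]
    exact periodic_smul_vec (f := fun v => φ v μ) (fun v i' => hφ v i' μ) w (-e i)
  have h := pushDir_shift L hWt φ ((L : ℤ) • z) κ
  rw [hφt] at h
  exact h

/-- The differential of the coordinates maps the restriction of a periodic direction to the restriction of its
push-forward: `D coord_id(W)(0) (res φ) = res (cpush L W φ)`. [folklore] -/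
theorem fderiv_coord_resDir {L N : ℕ} [NeZero N] [NeZero (L * N)] {W : Site d → Fin d → 𝕄ˣ}
    (hWb : ∀ (q : Site d) (κ : Fin d) (r : Fin d → Fin L), ‖((Wcx L W q κ (boxVec L r) : 𝕄ˣ) : 𝕄) - 1‖ < 1)
    {φ : Site d → Fin d → 𝕄} (hφ : IsPeriodicDir φ ((L * N : ℕ) : ℤ)) :
    (fderiv ℝ (coord (ContinuousLinearMap.id ℝ 𝕄) L N W) 0) (resDir (L * N) φ) = resDir N (cpush L W φ) := by
  funext r κ
  rw [fderiv_coord_apply (ContinuousLinearMap.id ℝ 𝕄) L N W hWb, chartDir_id_resDir (L * N) hφ]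
  rfl

/-- `twoLevelQ'_resDir_eq_zero` at a generic base: `cpush L W₁ φ = 0 ⇒ twoLevelQ' W₁ (res φ) = 0`. [folklore] -/
theorem twoLevelQ'_resDir_eq_zero' [Nonempty n] {L M' : ℕ} [NeZero L] [NeZero M'] {W₁ : Site d → Fin d → 𝕄ˣ}
    (hW₁ : IsUnitaryCfg W₁) {x : ℝ} (hx : 0 ≤ x) (hs : twoLevelSmall d L * x ≤ 1) (hW₁x : SmallField W₁ x)
    {φ : Site d → Fin d → 𝕄} (hφP : IsPeriodicDir φ ((L * M' : ℕ) : ℤ)) (hφT : cpush L W₁ φ = 0) :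
    twoLevelQ' L M' W₁ (resDir (L * M') φ) = 0 := by
  have hL : 1 ≤ L := Nat.one_le_iff_ne_zero.mpr (NeZero.ne L)
  apply Subtype.ext
  have hval : ((twoLevelQ' L M' W₁ (resDir (L * M') φ) : ↥(skewSub d n M')) : TDir d n M')
      = skewPF M' ((fderiv ℝ (coord (ContinuousLinearMap.id ℝ 𝕄) L M' W₁) 0) (resDir (L * M') φ)) := rfl
  rw [hval, Submodule.coe_zero, fderiv_coord_resDir (ball_of_small hL hW₁ hx hs hW₁x) hφP, hφT]
  exact map_zero _

/-- **TANGENCY IMPLIES ADMISSIBILITY at every level**: for a periodic direction `φ` at the base `W₁` (period `L·tower j`,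
unitary, small), `TangentIter L j W₁ φ ⇒ levelQ' j W₁ (res φ) = 0`. [folklore] -/
theorem levelQ'_resDir_eq_zero [Nonempty n] {L M' : ℕ} [NeZero L] [NeZero M'] (hL : 1 ≤ L) (j : ℕ) :
    ∀ {W₁ : Site d → Fin d → 𝕄ˣ} {x : ℝ}, IsUnitaryCfg W₁ → IsPeriodicCfg W₁ ((L : ℤ) * (tower L M' j : ℕ)) →
    0 ≤ x → LevelSmall d L j x → SmallField W₁ x → ∀ {φ : Site d → Fin d → 𝕄},
    IsPeriodicDir φ ((L * tower L M' j : ℕ) : ℤ) → TangentIter L j W₁ φ →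
      levelQ' L M' j W₁ (resDir (L * tower L M' j) φ) = 0 := by
  induction j with
  | zero =>
      intro W₁ x hW₁ _ hx hs hW₁x φ hφP hφT
      exact twoLevelQ'_resDir_eq_zero' hW₁ hx hs hW₁x hφP hφT
  | succ j ih =>
      intro W₁ x hW₁ hW₁P hx hs hW₁x φ hφP hφT
      obtain ⟨hlift, hr0, -, -⟩ := smallness_of_twoLevelSmall (d := d) hL hx hs.1
      have h512 := small512_of_liftSmall hL hx hlift
      have hφP' : IsPeriodicDir φ ((L : ℤ) * (L * tower L M' j : ℕ)) := by
        have e : ((L * tower L M' (j + 1) : ℕ) : ℤ) = (L : ℤ) * (L * tower L M' j : ℕ) := by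
          simp only [tower]; push_cast; ring
        rw [e] at hφP; exact hφP
      have hW₁P' : IsPeriodicCfg (cavg L W₁) ((L : ℤ) * (tower L M' j : ℕ)) := by
        have h := isPeriodicCfg_cavg L (tower L M' (j + 1)) hW₁P
        rw [natCast_tower_succ] at h
        exact h
      show (levelQ' L M' j (cavg L W₁)).comp
          (fderiv ℝ (coord (ContinuousLinearMap.id ℝ 𝕄) L (L * tower L M' j) W₁) 0) (resDir (L * (L * tower L M' j)) φ) = 0
      rw [ContinuousLinearMap.comp_apply, fderiv_coord_resDir (N := L * tower L M' j) (ball_of_small hL hW₁ hx hs.1 hW₁x) hφP]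
      exact ih (cavg_isUnitaryCfg hL hW₁ hx h512 hW₁x) hW₁P' hr0 hs.2
        (smallField_cavg hL hW₁ hx h512 hW₁x) (isPeriodicDir_cpush L _ hW₁P hφP') hφT

end

end Summit.QuantumFields.BalabanUV.T4Continuum.AveragingDeficitMultiLevelPrep
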